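import Summits.CriticalPhenomena.PercolationContinuityZ3.Theorems.PercAnnulusCrossingHarrisSlackVariance
import Summits.CriticalPhenomena.PercolationContinuityZ3.Theorems.PercAnnulusCrossingNoiseCritical
import Summits.CriticalPhenomena.PercolationContinuityZ3.Theorems.PercAnnulusCrossingNoiseAnnulus
import HarnessLib

/-!
# RSW3 lane (lead, gen 23): ANATOMY OF THE HARRIS SLACK, VI — PIVOTAL RENEWAL: at `p_c` no edge stays pivotal under a fixed noise
# (the cube crossing of `ℤ³`; the aspect-2 annulus and the arm in every `ℤ^d`, `d ≥ 2`)

builds on p205010 (kernel theorem, internal audit signed; external expert review pending) — USED in §2 through gen 20's noise-sensitivity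
theorems at `p_c` (`tendsto_cube_noise_criticalProbI`, `tendsto_annulus_noise_criticalProbI`, `tendsto_oneArm_noise_conditional_criticalProbI`,
all resting on `θ(p_c) = 0`).

Cell `prim-rsw3` (LANE 3), lead seat, gen 23.  Support file (`--supports stmt-CriticalPhenomena-4575`); no definitions, no named facts,
no sorries.  Part V wrote the variance as `∫_0^1 J_f(ε) dε` with the PIVOTAL AUTOCORRELATION `J_f(ε) = Σ_i p_i(1−p_i)·E[D_i f(ω)·D_i f(ω^ε)]`
non-increasing in `ε`; for an increasing event `A` of the lattice cube, `J(ε) = p(1−p)·E_p[#{edges pivotal for A in ω AND in ω^ε}]`.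

* §1 (abstract, every `p ∈ [0,1]^ι`, every real `f`): `intervalIntegrable_pivotal_autocorrelation`; **`mul_pivotal_autocorrelation_le`** —
  `(b − a)·J_f(b) ≤ E[f(ω)f(ω^a)] − E[f]²` for `0 ≤ a ≤ b ≤ 1` (`E[f f^a] − E[f]² = ∫_a^1 J_f ≥ ∫_a^b J_f ≥ (b−a)J_f(b)`): THE NOISE CORRELATION
  ABOVE THE SQUARED MEAN CONTROLS THE JOINT PIVOTALITY AT EVERY LARGER NOISE.
* §2 AT CRITICALITY (p205010), for every fixed `0 < ε ≤ 1`: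
  **`tendsto_cube_pivotal_autocorrelation_criticalProbI`** — `ℤ³`, the cube `{0..n}³`: `J_n(ε) = p_c(1−p_c)·E_{p_c}[#{pairs of Λ(n) pivotal for the
  crossing in ω and in ω^ε}] → 0` — NO EDGE STAYS PIVOTAL: the pivotal set of the critical cube crossing is completely renewed by any fixed
  amount of noise (while at `ε = 0`, `J_n(0) = p(1−p)E[N_piv] ≥ Π_n(1−Π_n)`, part V);
  **`tendsto_annulus_pivotal_autocorrelation_criticalProbI`** — every `d ≥ 2`, the aspect-2 annulus `Λ(L) ↔ ∂ⁱⁿΛ(2L)`: the same;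
  **`tendsto_oneArm_pivotal_autocorrelation_div_criticalProbI`** — every `d ≥ 2`, the arm `0 ↔ ∂ⁱⁿΛ(n)`: `J_n(ε)/π_{p_c}(n) → 0` — conditionally on
  the critical arm, the expected number of its pivotal (essential) edges that are still pivotal after an ε-noise tends to `0`, whereas the
  expected number of pivotal edges itself, `E[N_piv(arm_n)]/π(n)`, tends to `∞` (gen 22 `tendsto_oneArm_pivotal_div_atTop_criticalProbI`).
In Garban–Pete–Schramm's planar language: the pivotal set is asymptotically disjoint from its ε-perturbation; here in `ℤ³` (cube) and in every
`ℤ^d` (annulus, arm), without arm exponents, from `θ(p_c) = 0`.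

References: C. Garban, G. Pete, O. Schramm, *The Fourier spectrum of critical percolation*, Acta Math. 205 (2010) §1; I. Benjamini, G. Kalai,
O. Schramm, Publ. IHÉS 90 (1999) Thm 1.2; O. Schramm, J. Steif, Ann. of Math. 171 (2010) Cor 1.9; R. O'Donnell, CUP 2014, §2.4;
M. Talagrand, Combinatorica 16 (1996) §2.
-/

noncomputable section

/-! ## §1 The noise correlation above the squared mean controls the joint pivotality at larger noise -/

namespace Summit.CriticalPhenomena.PercolationContinuityZ3.Theorems.Crossing.Spectral

open Finset Function MeasureTheory intervalIntegral
open Literature.Probability.ODonnellSaksSchrammServedio2005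

variable {ι : Type*} [Fintype ι] [DecidableEq ι] (p : ι → ℝ) (h0 : ∀ i, 0 ≤ p i) (h1 : ∀ i, p i ≤ 1)

include h0 h1 in
/-- The pivotal autocorrelation is a polynomial in the noise level, hence interval-integrable. [folklore] -/
theorem intervalIntegrable_pivotal_autocorrelation (f : (ι → Bool) → ℝ) (a b : ℝ) :
    IntervalIntegrable (fun ε : ℝ => ∑ i, p i * (1 - p i) * ∑ x : ι → Bool, ∑ y : ι → Bool, ∑ m : ι → Bool,
        wt p x * wt p y * wt (fun _ => ε) m
          * ((f (update x i true) - f (update x i false))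
            * (f (update (fun j => if m j = true then y j else x j) i true)
              - f (update (fun j => if m j = true then y j else x j) i false)))) volume a b := by
  have hpoly : ∀ ε : ℝ, (∑ i, p i * (1 - p i) * ∑ x : ι → Bool, ∑ y : ι → Bool, ∑ m : ι → Bool, wt p x * wt p y * wt (fun _ => ε) m
        * ((f (update x i true) - f (update x i false))
          * (f (update (fun j => if m j = true then y j else x j) i true)
            - f (update (fun j => if m j = true then y j else x j) i false))))
      = ∑ S ∈ (Finset.univ : Finset ι).powerset, (S.card : ℝ) * ((1 - ε) ^ (S.card - 1)
          * (∑ x : ι → Bool, wt p x * (f x * ∏ j ∈ S,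
              (((if x j then (1 : ℝ) else 0) - p j) / Real.sqrt (p j * (1 - p j))))) ^ 2) :=
    fun ε => pivotal_autocorrelation_eq_sum_coeff_sq p h0 h1 f ε
  rw [show (fun ε : ℝ => ∑ i, p i * (1 - p i) * ∑ x : ι → Bool, ∑ y : ι → Bool, ∑ m : ι → Bool, wt p x * wt p y * wt (fun _ => ε) m
        * ((f (update x i true) - f (update x i false))
          * (f (update (fun j => if m j = true then y j else x j) i true)
            - f (update (fun j => if m j = true then y j else x j) i false))))
      = fun ε => ∑ S ∈ (Finset.univ : Finset ι).powerset, (S.card : ℝ) * ((1 - ε) ^ (S.card - 1)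
          * (∑ x : ι → Bool, wt p x * (f x * ∏ j ∈ S,
              (((if x j then (1 : ℝ) else 0) - p j) / Real.sqrt (p j * (1 - p j))))) ^ 2) from funext hpoly]
  exact (continuous_finsetSum _ fun S _ => by fun_prop).intervalIntegrable a b

include h0 h1 in
/-- **THE NOISE CORRELATION ABOVE THE SQUARED MEAN CONTROLS THE JOINT PIVOTALITY AT EVERY LARGER NOISE**: for every real `f`, every
`p ∈ [0,1]^ι` and `a ≤ b ≤ 1`, `(b − a)·J_f(b) ≤ E[f(ω)·f(ω^a)] − E[f]²` — since `E[f(ω)f(ω^a)] − E[f]² = ∫_a^1 J_f ≥ ∫_a^b J_f ≥ (b−a)·J_f(b)`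
(`J_f ≥ 0` non-increasing, part V). [cite: ODonnell2014, §2.4 (Stab_ρ[f] = Σ_S ρ^{|S|}f̂(S)² and its ρ-derivative)] [cite: Talagrand1996, §2] -/
theorem mul_pivotal_autocorrelation_le (f : (ι → Bool) → ℝ) {a b : ℝ} (hab : a ≤ b) (hb : b ≤ 1) :
    (b - a) * (∑ i, p i * (1 - p i) * ∑ x : ι → Bool, ∑ y : ι → Bool, ∑ m : ι → Bool, wt p x * wt p y * wt (fun _ => b) m
        * ((f (update x i true) - f (update x i false))
          * (f (update (fun j => if m j = true then y j else x j) i true)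
            - f (update (fun j => if m j = true then y j else x j) i false))))
      ≤ (∑ x : ι → Bool, ∑ y : ι → Bool, ∑ m : ι → Bool, wt p x * wt p y * wt (fun _ => a) m
          * (f x * f (fun i => if m i = true then y i else x i))) - (∑ x : ι → Bool, wt p x * f x) ^ 2 := by
  -- `E[f f^a] − E[f]² = ∫_a^1 J`
  have hint := noise_cross_correlation_sub_eq_integral p h0 h1 f f a 1
  rw [noise_one_eq p f f] at hint
  rw [sq, hint]
  -- split `∫_a^1 = ∫_a^b + ∫_b^1`
  have hI1 := intervalIntegrable_pivotal_autocorrelation p h0 h1 f a b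
  have hI2 := intervalIntegrable_pivotal_autocorrelation p h0 h1 f b 1
  rw [← intervalIntegral.integral_add_adjacent_intervals hI1 hI2]
  have hnn : 0 ≤ ∫ ε in b..1, ∑ i, p i * (1 - p i) * ∑ x : ι → Bool, ∑ y : ι → Bool, ∑ m : ι → Bool,
        wt p x * wt p y * wt (fun _ => ε) m
          * ((f (update x i true) - f (update x i false))
            * (f (update (fun j => if m j = true then y j else x j) i true)
              - f (update (fun j => if m j = true then y j else x j) i false))) :=
    intervalIntegral.integral_nonneg hb fun ε hε => pivotal_autocorrelation_nonneg p h0 h1 f hε.2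
  -- `∫_a^b J ≥ (b − a) J(b)`
  have hconst := intervalIntegral.integral_const (a := a) (b := b)
    (∑ i, p i * (1 - p i) * ∑ x : ι → Bool, ∑ y : ι → Bool, ∑ m : ι → Bool, wt p x * wt p y * wt (fun _ => b) m
        * ((f (update x i true) - f (update x i false))
          * (f (update (fun j => if m j = true then y j else x j) i true)
            - f (update (fun j => if m j = true then y j else x j) i false))))
  rw [smul_eq_mul] at hconst
  have hmono : ∫ ε in a..b, (∑ i, p i * (1 - p i) * ∑ x : ι → Bool, ∑ y : ι → Bool, ∑ m : ι → Bool, wt p x * wt p y * wt (fun _ => b) m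
        * ((f (update x i true) - f (update x i false))
          * (f (update (fun j => if m j = true then y j else x j) i true)
            - f (update (fun j => if m j = true then y j else x j) i false))))
      ≤ ∫ ε in a..b, ∑ i, p i * (1 - p i) * ∑ x : ι → Bool, ∑ y : ι → Bool, ∑ m : ι → Bool, wt p x * wt p y * wt (fun _ => ε) m
        * ((f (update x i true) - f (update x i false))
          * (f (update (fun j => if m j = true then y j else x j) i true)
            - f (update (fun j => if m j = true then y j else x j) i false))) :=
    intervalIntegral.integral_mono_on hab intervalIntegrable_const hI1 fun ε hε =>
      pivotal_autocorrelation_antitone p h0 h1 f hε.2 hb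
  rw [hconst] at hmono
  linarith

end Summit.CriticalPhenomena.PercolationContinuityZ3.Theorems.Crossing.Spectral

/-! ## §2 At criticality: the pivotal set is renewed by any fixed noise -/

namespace Summit.CriticalPhenomena.PercolationContinuityZ3.Theorems.Crossing

open MeasureTheory Finset Function Filter Topology
open Literature.Probability.Percolation Literature.Probability.LatticeModels
open Literature.Probability.ODonnellSaksSchrammServedio2005
open Literature.Probability.Percolation.GhostExploration Literature.Probability.Percolation.SeedExploration
open Literature.Probability.Percolation.OneArmOSSS Literature.Probability.Percolation.DCT16
open Summit.CriticalPhenomena.PercolationContinuityZ3.Theorems.SurfaceTension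
open Summit.CriticalPhenomena.PercolationContinuityZ3.Theorems.CrossingRevealment
open Summit.CriticalPhenomena.PercolationContinuityZ3.Theorems.Crossing.Spectral

variable {d : ℕ}

/-- Squeeze bookkeeping: a nonnegative sequence dominated by `(2/ε)`-times a null sequence is null. [folklore] -/
theorem tendsto_zero_of_le_const_mul {u v : ℕ → ℝ} {C : ℝ} (hu0 : ∀ n, 0 ≤ u n) (huv : ∀ n, u n ≤ C * v n)
    (hv : Tendsto v atTop (𝓝 0)) : Tendsto u atTop (𝓝 0) := by
  have hCv : Tendsto (fun n => C * v n) atTop (𝓝 0) := by simpa using hv.const_mul C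
  exact squeeze_zero hu0 huv hCv

/-- Real bookkeeping: `(ε/2)·J ≤ N` and `0 < ε` give `J ≤ (2/ε)·N`. [folklore] -/
theorem le_two_div_mul {ε J N : ℝ} (hε : 0 < ε) (h : ε / 2 * J ≤ N) : J ≤ 2 / ε * N := by
  rw [show (2 : ℝ) / ε * N = N / (ε / 2) by rw [div_div_eq_mul_div]; ring, le_div_iff₀ (by linarith)]
  linarith

/-- **PIVOTAL RENEWAL FOR THE CRITICAL CUBE OF `ℤ³`**: for every fixed `0 < ε ≤ 1`, with `g_n` the indicator of the crossing of `{0..n}³` in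
direction `0` read on the lattice cube of `Λ(n)` and `b = boxBias 3 n p_c`,
`J_n(ε) = Σ_e b_e(1−b_e)·E_{p_c}[D_e g_n(ω)·D_e g_n(ω^ε)] → 0` — `p_c(1−p_c)` times the expected number of edges pivotal for the crossing
BOTH in `ω` and in its ε-noised copy tends to zero: no edge stays pivotal (gen 20's noise sensitivity at `p_c(ℤ³)` and §1 with `a = ε/2`,
`b = ε`). [cite: GarbanPeteSchramm2010, §1 (the pivotal and spectral sets under perturbation)] [cite: BenjaminiKalaiSchramm1999, Thm 1.2] -/
theorem tendsto_cube_pivotal_autocorrelation_criticalProbI {ε : ℝ} (hε0 : 0 < ε) (hε1 : ε ≤ 1) :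
    Tendsto (fun n : ℕ => ∑ e : PairIdx 3 n, boxBias 3 n (criticalProbI 3) e * (1 - boxBias 3 n (criticalProbI 3) e)
      * ∑ x : PairIdx 3 n → Bool, ∑ y : PairIdx 3 n → Bool, ∑ ν : PairIdx 3 n → Bool,
          wt (boxBias 3 n (criticalProbI 3)) x * wt (boxBias 3 n (criticalProbI 3)) y * wt (fun _ => ε) ν
          * ((gcross (fun a b : BoxV 3 n => if a.1 ∈ Icc 0 (cubeShape n) ∧ b.1 ∈ Icc 0 (cubeShape n) then latEdge 3 n a b else none)
                {v : BoxV 3 n | v.1 ∈ Icc 0 (cubeShape n) ∧ v.1 0 = 0} {v : BoxV 3 n | v.1 ∈ Icc 0 (cubeShape n) ∧ v.1 0 = cubeShape n 0}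
                (update x e true)
              - gcross (fun a b : BoxV 3 n => if a.1 ∈ Icc 0 (cubeShape n) ∧ b.1 ∈ Icc 0 (cubeShape n) then latEdge 3 n a b else none)
                {v : BoxV 3 n | v.1 ∈ Icc 0 (cubeShape n) ∧ v.1 0 = 0} {v : BoxV 3 n | v.1 ∈ Icc 0 (cubeShape n) ∧ v.1 0 = cubeShape n 0}
                (update x e false))
            * (gcross (fun a b : BoxV 3 n => if a.1 ∈ Icc 0 (cubeShape n) ∧ b.1 ∈ Icc 0 (cubeShape n) then latEdge 3 n a b else none)
                {v : BoxV 3 n | v.1 ∈ Icc 0 (cubeShape n) ∧ v.1 0 = 0} {v : BoxV 3 n | v.1 ∈ Icc 0 (cubeShape n) ∧ v.1 0 = cubeShape n 0}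
                (update (fun j => if ν j = true then y j else x j) e true)
              - gcross (fun a b : BoxV 3 n => if a.1 ∈ Icc 0 (cubeShape n) ∧ b.1 ∈ Icc 0 (cubeShape n) then latEdge 3 n a b else none)
                {v : BoxV 3 n | v.1 ∈ Icc 0 (cubeShape n) ∧ v.1 0 = 0} {v : BoxV 3 n | v.1 ∈ Icc 0 (cubeShape n) ∧ v.1 0 = cubeShape n 0}
                (update (fun j => if ν j = true then y j else x j) e false))))
      atTop (𝓝 0) := by
  classical
  have hε2 : 0 < ε / 2 := by linarith
  have hε2' : ε / 2 ≤ 1 := by linarith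
  have hns := tendsto_cube_noise_criticalProbI hε2 hε2'
  refine tendsto_zero_of_le_const_mul (C := 2 / ε) (fun n => ?_) (fun n => ?_) hns
  · exact pivotal_autocorrelation_nonneg (boxBias 3 n (criticalProbI 3)) (boxBias_nonneg n (criticalProbI 3).2.1)
      (boxBias_le_one n (criticalProbI 3).2.2) _ hε1
  · have h := mul_pivotal_autocorrelation_le (boxBias 3 n (criticalProbI 3)) (boxBias_nonneg n (criticalProbI 3).2.1)
      (boxBias_le_one n (criticalProbI 3).2.2)
      (gcross (fun a b : BoxV 3 n => if a.1 ∈ Icc 0 (cubeShape n) ∧ b.1 ∈ Icc 0 (cubeShape n) then latEdge 3 n a b else none)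
        {v : BoxV 3 n | v.1 ∈ Icc 0 (cubeShape n) ∧ v.1 0 = 0} {v : BoxV 3 n | v.1 ∈ Icc 0 (cubeShape n) ∧ v.1 0 = cubeShape n 0})
      (by linarith : ε / 2 ≤ ε) hε1
    rw [sum_wt_gcross_hyperplanes_eq (cubeShape n) 0 n (Icc_cubeShape_subset_box n) (criticalProbI 3)] at h
    have hεε : ε - ε / 2 = ε / 2 := by ring
    rw [hεε] at h
    -- `J ≤ (2/ε)·(E[g g^{ε/2}] − Π²)`
    exact le_two_div_mul hε0 h

/-- **PIVOTAL RENEWAL FOR THE CRITICAL ANNULUS IN EVERY DIMENSION** (`d ≥ 2`, aspect 2: `Λ(L) ↔ ∂ⁱⁿΛ(2L)` read on the cube of `Λ(2L)`):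
for every fixed `0 < ε ≤ 1`, `Σ_e b_e(1−b_e)·E_{p_c}[D_e𝟙_L(ω)·D_e𝟙_L(ω^ε)] → 0` as `L → ∞` — the expected (`p_c(1−p_c)`-weighted) number of edges
pivotal for the annulus crossing before and after an ε-noise tends to zero (gen 20's `tendsto_annulus_noise_criticalProbI` and §1).
[cite: GarbanPeteSchramm2010, §1] [cite: SchrammSteif2010, Cor 1.9] -/
theorem tendsto_annulus_pivotal_autocorrelation_criticalProbI (hd : 2 ≤ d) {ε : ℝ} (hε0 : 0 < ε) (hε1 : ε ≤ 1) :
    Tendsto (fun L : ℕ => ∑ e : PairIdx d (2 * L), boxBias d (2 * L) (criticalProbI d) e * (1 - boxBias d (2 * L) (criticalProbI d) e)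
      * ∑ x : PairIdx d (2 * L) → Bool, ∑ y : PairIdx d (2 * L) → Bool, ∑ ν : PairIdx d (2 * L) → Bool,
          wt (boxBias d (2 * L) (criticalProbI d)) x * wt (boxBias d (2 * L) (criticalProbI d)) y * wt (fun _ => ε) ν
          * ((gcross (latEdge d (2 * L)) (sphereSeed d (2 * L) L) (sphereSeed d (2 * L) (2 * L)) (update x e true)
              - gcross (latEdge d (2 * L)) (sphereSeed d (2 * L) L) (sphereSeed d (2 * L) (2 * L)) (update x e false))
            * (gcross (latEdge d (2 * L)) (sphereSeed d (2 * L) L) (sphereSeed d (2 * L) (2 * L))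
                (update (fun j => if ν j = true then y j else x j) e true)
              - gcross (latEdge d (2 * L)) (sphereSeed d (2 * L) L) (sphereSeed d (2 * L) (2 * L))
                (update (fun j => if ν j = true then y j else x j) e false))))
      atTop (𝓝 0) := by
  classical
  have hd1 : 1 ≤ d := le_trans (by norm_num) hd
  have hε2 : 0 < ε / 2 := by linarith
  have hε2' : ε / 2 ≤ 1 := by linarith
  have hns := tendsto_annulus_noise_criticalProbI hd hε2 hε2'
  refine tendsto_zero_of_le_const_mul (C := 2 / ε) (fun L => ?_) (fun L => ?_) hns
  · exact pivotal_autocorrelation_nonneg (boxBias d (2 * L) (criticalProbI d)) (boxBias_nonneg (2 * L) (criticalProbI d).2.1)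
      (boxBias_le_one (2 * L) (criticalProbI d).2.2) _ hε1
  · have h := mul_pivotal_autocorrelation_le (boxBias d (2 * L) (criticalProbI d)) (boxBias_nonneg (2 * L) (criticalProbI d).2.1)
      (boxBias_le_one (2 * L) (criticalProbI d).2.2)
      (gcross (latEdge d (2 * L)) (sphereSeed d (2 * L) L) (sphereSeed d (2 * L) (2 * L))) (by linarith : ε / 2 ≤ ε) hε1
    rw [sum_wt_gcross_eq hd1 (by omega : L ≤ 2 * L) (criticalProbI d)] at h
    have hεε : ε - ε / 2 = ε / 2 := by ring
    rw [hεε] at h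
    exact le_two_div_mul hε0 h

/-- **PIVOTAL RENEWAL FOR THE CRITICAL ARM IN EVERY DIMENSION** (`d ≥ 2`; the arm `0 ↔ ∂ⁱⁿΛ(n)` read on the cube of `Λ(n)`, probability
`π_{p_c}(n) → 0`): for every fixed `0 < ε ≤ 1`, `Σ_e b_e(1−b_e)·E_{p_c}[D_e𝟙(ω)·D_e𝟙(ω^ε)] / π_{p_c}(n) → 0` — CONDITIONALLY ON THE CRITICAL ARM, the
expected number of its pivotal edges that remain pivotal after an ε-noise tends to zero, while the expected number of pivotal edges itself,
`E[N_piv(arm_n)]/π(n)`, tends to infinity (gen 22) — every essential edge of the arm is renewed (gen 22's conditional noise fragility of the arm,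
`tendsto_oneArm_noise_conditional_criticalProbI`, and §1). [cite: GarbanPeteSchramm2010, §1] [cite: BenjaminiKalaiSchramm1999, §1.4] -/
theorem tendsto_oneArm_pivotal_autocorrelation_div_criticalProbI (hd : 2 ≤ d) {ε : ℝ} (hε0 : 0 < ε) (hε1 : ε ≤ 1) :
    Tendsto (fun n : ℕ => (∑ e : PairIdx d n, boxBias d n (criticalProbI d) e * (1 - boxBias d n (criticalProbI d) e)
      * ∑ x : PairIdx d n → Bool, ∑ y : PairIdx d n → Bool, ∑ ν : PairIdx d n → Bool,
          wt (boxBias d n (criticalProbI d)) x * wt (boxBias d n (criticalProbI d)) y * wt (fun _ => ε) ν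
          * ((gcross (latEdge d n) (sphereSeed d n 0) (sphereSeed d n n) (update x e true)
              - gcross (latEdge d n) (sphereSeed d n 0) (sphereSeed d n n) (update x e false))
            * (gcross (latEdge d n) (sphereSeed d n 0) (sphereSeed d n n) (update (fun j => if ν j = true then y j else x j) e true)
              - gcross (latEdge d n) (sphereSeed d n 0) (sphereSeed d n n) (update (fun j => if ν j = true then y j else x j) e false))))
        / oneArmProb d (criticalProbI d) n)
      atTop (𝓝 0) := by
  classical
  have hε2 : 0 < ε / 2 := by linarith
  have hε2' : ε / 2 ≤ 1 := by linarith
  have hns := tendsto_oneArm_noise_conditional_criticalProbI hd hε2 hε2'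
  refine tendsto_zero_of_le_const_mul (C := 2 / ε) (fun n => ?_) (fun n => ?_) hns
  · exact div_nonneg (pivotal_autocorrelation_nonneg (boxBias d n (criticalProbI d)) (boxBias_nonneg n (criticalProbI d).2.1)
      (boxBias_le_one n (criticalProbI d).2.2) _ hε1) measureReal_nonneg
  · have h := mul_pivotal_autocorrelation_le (boxBias d n (criticalProbI d)) (boxBias_nonneg n (criticalProbI d).2.1)
      (boxBias_le_one n (criticalProbI d).2.2)
      (gcross (latEdge d n) (sphereSeed d n 0) (sphereSeed d n n)) (by linarith : ε / 2 ≤ ε) hε1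
    have hεε : ε - ε / 2 = ε / 2 := by ring
    rw [hεε] at h
    -- drop the squared mean, solve for `J`, divide by `π ≥ 0`
    have h2 := le_two_div_mul hε0 (h.trans (sub_le_self _ (sq_nonneg _)))
    have hπ : 0 ≤ oneArmProb d (criticalProbI d) n := measureReal_nonneg
    exact (div_le_div_of_nonneg_right h2 hπ).trans_eq (mul_div_assoc _ _ _)

end Summit.CriticalPhenomena.PercolationContinuityZ3.Theorems.Crossing

end
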